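import Mathlib
import HarnessLib
import Literature.Analysis.FluidPDE.TaoCascadeODE
import Summits.NavierStokesRegularity.NavierStokesRegularity.Theorems.SubOnsagerCeilingKPWeightConjugacy
import Summits.NavierStokesRegularity.NavierStokesRegularity.Theorems.SubOnsagerCeilingKPChainKolmogorovForm
import Summits.NavierStokesRegularity.NavierStokesRegularity.Theorems.SubOnsagerCeilingKPChainFrontExponent

/-!
# The Dombre–Gilson / Mailybaev renormalised clock for Tao-type cascade lattices (second step of the front renormalisation)
# (helper file for the crux `SubOnsagerCeiling.ForwardTailCeilingKP`, stmt-NavierStokesRegularity-27057, `--supports`)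

`Theorems/SubOnsagerCeilingKPWeightConjugacy.lean` (hand leafhand-4-g2) is the FIRST step of the Dombre–Gilson renormalisation:
in the Katz–Pavlović weights `W_{j,k} = λ^k X_{j,k}`, `λ = (1+ε₀)^{5/2}`, Tao's cascade nonlinearity is shell-free and
quadratic.  This file is the SECOND step, the renormalised clock [cite: DombreGilson1998, §3]
[cite: Mailybaev2013Bifurcations, §3 (eqs. (9)–(12)), Thm. 2]: along any `C¹` time change `t = T(σ)` with
`T'(σ) = e^{-S(σ)}`, `S'(σ) = A`, the renormalised amplitudes `v_{j,k}(σ) := e^{-S(σ)} W_{j,k}(T(σ))` of a solution of the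
viscous model equation `X' = quadTerm ε₀ α X − ν(1+ε₀)^{2k}X` obey

  `v_{i,k}' = Σ_{i₁,i₂} Σ_{μ∈S} α_{i₁i₂i}^{μ} λ^{μ₃−μ₁−μ₂} v_{i₁,k−μ₃+μ₁} v_{i₂,k−μ₃+μ₂} − A·v_{i,k} − ν(1+ε₀)^{2k} e^{-S} v_{i,k}`

(`dombreGilson_hasDerivAt`; the raw chain-rule form is `dombreGilson_hasDerivAt_raw`, the algebra `dombreGilson_nonlinearity`):
an AUTONOMOUS quadratic lattice plus the gauge term `−A v` (the viscosity acquires the factor `e^{-S} → 0` at the blow-up).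
Choosing `A = Σ_j v_j P_j / Σ_j v_j²` on a finite block (`P` = the quadratic part) conserves `Σ_j v_j²`
(`dombreGilson_norm_conserved`), which is the normalisation under which the blow-up front of the chain is a travelling wave
`v_k(σ) = aV(k − aσ)` of the shell-shift Poincaré map with exponent `y = (log λ)⁻¹ ∮ A dσ`, i.e. per-shell sups
`sup_t X_k ≍ λ^{(y−1)k}` and `θ_front = (5/2)(1−y)` in the dictionary of `Theorems/SubOnsagerCeilingKPChainFrontExponent.lean`
(evidence DG-FRONT-CENSUS-leafhand4-g2 / TW-EXPONENT-leafhand4-g16 on the item: `y ≤ 0.7588 < 4/5` numerically on `b ∈ (1,2]`).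
The statements hold for EVERY table `α` (all primary networks of the registered stubs), at a point, with `HasDerivAt`
hypotheses (interior points of an honest solution on `[0,s]`).

HONEST FRAMING: calculus identities about Tao-type MODEL lattice ODEs (route SubOnsagerCeiling, rung TL-M2Break); no stub, crux
or summit is proved here and nothing in this file bears on Navier–Stokes regularity.
[cite: Tao2016AveragedNS, §4 (4.8), (4.13)]
-/

noncomputable section

-- the sub-problem namespace `NavierStokesRegularity.NavierStokesRegularity` is the tree's layout (D-0017)
set_option linter.dupNamespace false

namespace Summit.NavierStokesRegularity.NavierStokesRegularity.Theorems

open Finset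
open Literature.Analysis.FluidPDE.TaoCascade

/-- **Renormalised clock, raw chain-rule form.** If `T' = e^{-S}` and `S' = A` at `σ` and `X_{i,k}` obeys the viscous model
equation at `T σ`, then `v(σ') = e^{-S(σ')} λ^k X_{i,k}(T σ')` has derivative
`e^{-S}·e^{-S}·(λ^k·quadTerm) − A·v − ν(1+ε₀)^{2k} e^{-S} v` at `σ`. [cite: DombreGilson1998, §3]
[cite: Mailybaev2013Bifurcations, §3 (9)–(11)] -/
theorem dombreGilson_hasDerivAt_raw {ε₀ ν : ℝ} {m : ℕ} {α : Fin m → Fin m → Fin m → ℤ × ℤ × ℤ → ℝ}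
    {X : Fin m → ℤ → ℝ → ℝ} {T S : ℝ → ℝ} {A σ : ℝ} {i : Fin m} {k : ℤ}
    (hT : HasDerivAt T (Real.exp (-(S σ))) σ) (hS : HasDerivAt S A σ)
    (hX : HasDerivAt (X i k)
      (quadTerm ε₀ α X i k (T σ) - ν * (1 + ε₀) ^ ((2 : ℝ) * k) * X i k (T σ)) (T σ)) :
    HasDerivAt (fun σ' => Real.exp (-(S σ')) * ((1 + ε₀) ^ ((5 : ℝ) / 2 * (k : ℝ)) * X i k (T σ')))
      (Real.exp (-(S σ)) * Real.exp (-(S σ)) * ((1 + ε₀) ^ ((5 : ℝ) / 2 * (k : ℝ)) * quadTerm ε₀ α X i k (T σ)) -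
        A * (Real.exp (-(S σ)) * ((1 + ε₀) ^ ((5 : ℝ) / 2 * (k : ℝ)) * X i k (T σ))) -
        ν * (1 + ε₀) ^ ((2 : ℝ) * k) * Real.exp (-(S σ)) *
          (Real.exp (-(S σ)) * ((1 + ε₀) ^ ((5 : ℝ) / 2 * (k : ℝ)) * X i k (T σ)))) σ := by
  -- the clock factor `e^{-S}`
  have hE : HasDerivAt (fun σ' => Real.exp (-(S σ'))) (Real.exp (-(S σ)) * (-A)) σ := hS.neg.exp
  -- the weighted amplitude read at the new time
  have hcomp : HasDerivAt (fun σ' => X i k (T σ'))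
      ((quadTerm ε₀ α X i k (T σ) - ν * (1 + ε₀) ^ ((2 : ℝ) * k) * X i k (T σ)) * Real.exp (-(S σ))) σ :=
    hX.comp σ hT
  have hW := hcomp.const_mul ((1 + ε₀) ^ ((5 : ℝ) / 2 * (k : ℝ)))
  have h := hE.mul hW
  refine h.congr_deriv ?_
  ring

/-- **The renormalised nonlinearity is the shell-free quadratic form in `v`.** With `v_{j,ℓ} = e^{-S} λ^ℓ X_{j,ℓ}(T σ)`:
`e^{-S} e^{-S} (λ^k · quadTerm ε₀ α X i k (Tσ)) = Σ_{i₁,i₂} Σ_{μ∈S} α i₁ i₂ i μ · λ^{μ₃−μ₁−μ₂} · v_{i₁,k−μ₃+μ₁} v_{i₂,k−μ₃+μ₂}`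
(KP weight conjugacy `kpWeight_quadTerm` and bilinearity). [cite: DombreGilson1998, §3] [cite: Tao2016AveragedNS, §4 (4.8)] -/
theorem dombreGilson_nonlinearity {ε₀ : ℝ} (hε : 0 < ε₀) {m : ℕ} (α : Fin m → Fin m → Fin m → ℤ × ℤ × ℤ → ℝ)
    (X : Fin m → ℤ → ℝ → ℝ) (T S : ℝ → ℝ) (σ : ℝ) (i : Fin m) (k : ℤ) :
    Real.exp (-(S σ)) * Real.exp (-(S σ)) * ((1 + ε₀) ^ ((5 : ℝ) / 2 * (k : ℝ)) * quadTerm ε₀ α X i k (T σ)) =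
      ∑ i₁ : Fin m, ∑ i₂ : Fin m, ∑ μ ∈ shiftSet,
        α i₁ i₂ i μ * (1 + ε₀) ^ ((5 : ℝ) / 2 * ((μ.2.2 : ℝ) - (μ.1 : ℝ) - (μ.2.1 : ℝ))) *
          ((Real.exp (-(S σ)) * ((1 + ε₀) ^ ((5 : ℝ) / 2 * ((k - μ.2.2 + μ.1 : ℤ) : ℝ)) * X i₁ (k - μ.2.2 + μ.1) (T σ))) *
            (Real.exp (-(S σ)) * ((1 + ε₀) ^ ((5 : ℝ) / 2 * ((k - μ.2.2 + μ.2.1 : ℤ) : ℝ)) * X i₂ (k - μ.2.2 + μ.2.1) (T σ)))) := by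
  rw [kpWeight_quadTerm hε α X i k (T σ), Finset.mul_sum]
  refine Finset.sum_congr rfl fun i₁ _ => ?_
  rw [Finset.mul_sum]
  refine Finset.sum_congr rfl fun i₂ _ => ?_
  rw [Finset.mul_sum]
  refine Finset.sum_congr rfl fun μ _ => ?_
  ring

/-- **The Dombre–Gilson renormalised lattice.** Under the clock `T' = e^{-S}`, `S' = A` the renormalised amplitudes
`v_{j,ℓ}(σ) = e^{-S(σ)} λ^ℓ X_{j,ℓ}(T σ)` of a solution of Tao's viscous model equation satisfy, at `σ`,
`v_{i,k}' = Σ_{i₁,i₂} Σ_{μ∈S} α i₁ i₂ i μ λ^{μ₃−μ₁−μ₂} v_{i₁,k−μ₃+μ₁} v_{i₂,k−μ₃+μ₂} − A v_{i,k} − ν(1+ε₀)^{2k} e^{-S} v_{i,k}` — an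
autonomous shell-homogeneous quadratic lattice with a gauge term; for the one-mode chain this is
`v_k' = λ v_{k-1}² − λ⁻¹ v_k v_{k+1} − A v_k − ν b^{2k} e^{-S} v_k`. [cite: DombreGilson1998, §3]
[cite: Mailybaev2013Bifurcations, §3 (9)–(12), Thm. 2] -/
theorem dombreGilson_hasDerivAt {ε₀ ν : ℝ} (hε : 0 < ε₀) {m : ℕ} {α : Fin m → Fin m → Fin m → ℤ × ℤ × ℤ → ℝ}
    {X : Fin m → ℤ → ℝ → ℝ} {T S : ℝ → ℝ} {A σ : ℝ} {i : Fin m} {k : ℤ}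
    (hT : HasDerivAt T (Real.exp (-(S σ))) σ) (hS : HasDerivAt S A σ)
    (hX : HasDerivAt (X i k)
      (quadTerm ε₀ α X i k (T σ) - ν * (1 + ε₀) ^ ((2 : ℝ) * k) * X i k (T σ)) (T σ)) :
    HasDerivAt (fun σ' => Real.exp (-(S σ')) * ((1 + ε₀) ^ ((5 : ℝ) / 2 * (k : ℝ)) * X i k (T σ')))
      ((∑ i₁ : Fin m, ∑ i₂ : Fin m, ∑ μ ∈ shiftSet,
        α i₁ i₂ i μ * (1 + ε₀) ^ ((5 : ℝ) / 2 * ((μ.2.2 : ℝ) - (μ.1 : ℝ) - (μ.2.1 : ℝ))) *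
          ((Real.exp (-(S σ)) * ((1 + ε₀) ^ ((5 : ℝ) / 2 * ((k - μ.2.2 + μ.1 : ℤ) : ℝ)) * X i₁ (k - μ.2.2 + μ.1) (T σ))) *
            (Real.exp (-(S σ)) *
              ((1 + ε₀) ^ ((5 : ℝ) / 2 * ((k - μ.2.2 + μ.2.1 : ℤ) : ℝ)) * X i₂ (k - μ.2.2 + μ.2.1) (T σ))))) -
        A * (Real.exp (-(S σ)) * ((1 + ε₀) ^ ((5 : ℝ) / 2 * (k : ℝ)) * X i k (T σ))) -
        ν * (1 + ε₀) ^ ((2 : ℝ) * k) * Real.exp (-(S σ)) *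
          (Real.exp (-(S σ)) * ((1 + ε₀) ^ ((5 : ℝ) / 2 * (k : ℝ)) * X i k (T σ)))) σ := by
  rw [← dombreGilson_nonlinearity hε α X T S σ i k]
  exact dombreGilson_hasDerivAt_raw hT hS hX

/-- **Norm conservation fixes the gauge.** On a finite block of modes `J`, if every renormalised amplitude obeys
`v_j' = P_j − A v_j` at `σ` and the gauge is chosen with `A · Σ_{j∈J} v_j(σ)² = Σ_{j∈J} v_j(σ) P_j` (e.g.
`A = Σ v_j P_j / Σ v_j²`, Mailybaev's (12) with the quadratic norm), then `Σ_{j∈J} v_j²` is stationary at `σ`: the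
renormalised dynamics lives on a sphere and the blow-up time is sent to `σ = +∞`. [cite: Mailybaev2013Bifurcations, §3 (12), Lemma 1] -/
theorem dombreGilson_norm_conserved {ι : Type*} (J : Finset ι) {v : ι → ℝ → ℝ} {P : ι → ℝ} {A σ : ℝ}
    (hv : ∀ j ∈ J, HasDerivAt (v j) (P j - A * v j σ) σ)
    (hA : A * ∑ j ∈ J, v j σ ^ 2 = ∑ j ∈ J, v j σ * P j) :
    HasDerivAt (fun σ' => ∑ j ∈ J, v j σ' ^ 2) 0 σ := by
  have hsq : ∀ j ∈ J, HasDerivAt (fun σ' => v j σ' ^ 2) (2 * v j σ * (P j - A * v j σ)) σ := by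
    intro j hj
    have h := (hv j hj).pow 2
    refine h.congr_deriv ?_
    simp
  have hsum := HasDerivAt.sum hsq
  have hzero : ∑ j ∈ J, 2 * v j σ * (P j - A * v j σ) = 0 := by
    have h1 : ∑ j ∈ J, 2 * v j σ * (P j - A * v j σ) =
        2 * (∑ j ∈ J, v j σ * P j) - 2 * (A * ∑ j ∈ J, v j σ ^ 2) := by
      rw [Finset.mul_sum, Finset.mul_sum, Finset.mul_sum, ← Finset.sum_sub_distrib]
      refine Finset.sum_congr rfl fun j _ => ?_
      ring
    rw [h1, hA]; ring
  rw [hzero] at hsum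
  refine hsum.congr_of_eventuallyEq (Filter.Eventually.of_forall fun σ' => ?_)
  simp [Finset.sum_apply]

/-- **The renormalised clock for the one-mode chain in the LEAD's format.** If `Z` (shells `k : ℕ`, `Z_{-1} ≡ 0`) obeys
`Ż_k = c₀ (b^{5(k-1)/2} Z_{k-1}² − b^{5k/2} Z_k Z_{k+1}) − ν b^{2k} Z_k` at the point `T σ`, and `T' = e^{-S}`, `S' = A` at `σ`,
then with `λ = b^{5/2}` the renormalised amplitudes `v_k(σ') = e^{-S(σ')} λ^k Z_k(T σ')` satisfy
`v_k' = c₀ (λ v_{k-1}² − λ⁻¹ v_k v_{k+1}) − A v_k − ν b^{2k} e^{-S} v_k` at `σ` (for `k = 0` read `v_{-1} = e^{-S} λ^0 Z_{-1} = 0`).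
This is the lattice integrated in the front censuses (DG-FRONT-CENSUS-leafhand4-g2, TW-EXPONENT-leafhand4-g16).
[cite: DombreGilson1998, §3] [cite: Mailybaev2013Bifurcations, §3 (9)–(12)] -/
theorem kpChain_dombreGilson_hasDerivAt {b c₀ ν : ℝ} (hb : 0 < b) {Z : ℤ → ℝ → ℝ} {T S : ℝ → ℝ} {A σ : ℝ}
    (hvan : ∀ t, Z (-1) t = 0)
    (hT : HasDerivAt T (Real.exp (-(S σ))) σ) (hS : HasDerivAt S A σ)
    (k : ℕ)
    (hode : HasDerivAt (Z k)
      (c₀ * (b ^ ((5 : ℝ) * ((k : ℝ) - 1) / 2) * Z ((k : ℤ) - 1) (T σ) ^ 2 -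
          b ^ ((5 : ℝ) * (k : ℝ) / 2) * (Z k (T σ) * Z ((k : ℤ) + 1) (T σ))) -
        ν * b ^ ((2 : ℝ) * (k : ℝ)) * Z k (T σ)) (T σ)) :
    HasDerivAt (fun σ' => Real.exp (-(S σ')) * ((b ^ ((5 : ℝ) / 2)) ^ k * Z k (T σ')))
      (c₀ * ((b ^ ((5 : ℝ) / 2)) * (Real.exp (-(S σ)) * ((b ^ ((5 : ℝ) / 2)) ^ (k - 1) * Z ((k : ℤ) - 1) (T σ))) ^ 2 -
          (b ^ ((5 : ℝ) / 2))⁻¹ * ((Real.exp (-(S σ)) * ((b ^ ((5 : ℝ) / 2)) ^ k * Z k (T σ))) *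
            (Real.exp (-(S σ)) * ((b ^ ((5 : ℝ) / 2)) ^ (k + 1) * Z ((k : ℤ) + 1) (T σ))))) -
        A * (Real.exp (-(S σ)) * ((b ^ ((5 : ℝ) / 2)) ^ k * Z k (T σ))) -
        ν * b ^ ((2 : ℝ) * (k : ℝ)) * Real.exp (-(S σ)) *
          (Real.exp (-(S σ)) * ((b ^ ((5 : ℝ) / 2)) ^ k * Z k (T σ)))) σ := by
  set L : ℝ := b ^ ((5 : ℝ) / 2) with hL
  have hLpos : 0 < L := Real.rpow_pos_of_pos hb _
  have hLne : L ≠ 0 := hLpos.ne'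
  have hL3 : (b ^ ((5 : ℝ) / 6)) ^ 3 = L := KPChainFront.kolmogorovWeight_pow_three hb
  -- clock factor and the amplitude read at the new time
  have hE : HasDerivAt (fun σ' => Real.exp (-(S σ'))) (Real.exp (-(S σ)) * (-A)) σ := hS.neg.exp
  have hcomp := hode.comp σ hT
  have hW := hcomp.const_mul (L ^ k)
  have h := hE.mul hW
  refine h.congr_deriv ?_
  rcases Nat.eq_zero_or_pos k with rfl | hk
  · -- datum shell: the feed terms vanish on both sides
    have hv : Z (((0 : ℕ) : ℤ) - 1) (T σ) = 0 := by simpa using hvan (T σ)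
    rw [hv]
    have h0 : b ^ ((5 : ℝ) * ((0 : ℕ) : ℝ) / 2) = 1 := by simp
    rw [h0]
    simp only [Function.comp]
    field_simp
    ring
  · obtain ⟨m, rfl⟩ : ∃ m, k = m + 1 := ⟨k - 1, by omega⟩
    rw [KPChainFront.feedWeight_eq_pow hb m, KPChainFront.drainWeight_eq_pow hb (m + 1), hL3]
    have hkm : m + 1 - 1 = m := by omega
    rw [hkm]
    simp only [Function.comp]
    field_simp
    ring

/-- **Travelling wave ⇒ exact Dombre–Gilson peak law** (Mailybaev's Theorem 2 in lattice form). Suppose the renormalised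
amplitudes are a travelling wave of the shell-shift Poincaré map with speed `a` (`a ≠ 0` implicit in the period `1/a`) — `v_{n+1}(σ + 1/a) = v_n(σ)` — and the
gauge integral gains `y·log λ` per period, `S(σ + 1/a) = S(σ) + y log λ` (`y = (log λ)⁻¹ ∮ A dσ`). Then the physical amplitudes
`X_n(T σ) = e^{S(σ)} v_n(σ)/λ^n` reproduce themselves shell by shell in the DG scaling:
`X_n(T(σ + n/a)) = λ^{(y−1)n} · X_0(T σ)` — so the per-shell peaks obey `m_n = λ^{(y−1)n} m_0` exactly, the hypothesis format of
`Theorems.kpFront_barrier_of_exponent_lt` / `kpFront_noBarrier_of_exponent_ge` (`θ_front = (5/2)(1−y)` for `λ = b^{5/2}`).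
[cite: Mailybaev2013Bifurcations, §4 Thm. 2 (eqs. (17), (21))] [cite: DombreGilson1998, §3] -/
theorem dombreGilson_travellingWave_peakLaw {lam a y : ℝ} (hlam : 0 < lam)
    {v X : ℕ → ℝ → ℝ} {T S : ℝ → ℝ}
    (hTW : ∀ (n : ℕ) (σ : ℝ), v (n + 1) (σ + 1 / a) = v n σ)
    (hS : ∀ σ : ℝ, S (σ + 1 / a) = S σ + y * Real.log lam)
    (hX : ∀ (n : ℕ) (σ : ℝ), X n (T σ) = Real.exp (S σ) * v n σ / lam ^ n) (n : ℕ) (σ : ℝ) :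
    X n (T (σ + n / a)) = lam ^ ((y - 1) * n) * X 0 (T σ) := by
  -- the wave and the gauge after `n` periods
  have hper : ∀ m : ℕ, ∀ τ : ℝ, v m (τ + m / a) = v 0 τ ∧ S (τ + m / a) = S τ + m * (y * Real.log lam) := by
    intro m
    induction m with
    | zero => intro τ; simp
    | succ m ih =>
      intro τ
      have hsplit : τ + ((m + 1 : ℕ) : ℝ) / a = (τ + m / a) + 1 / a := by push_cast; ring
      obtain ⟨hv, hs⟩ := ih τ
      refine ⟨?_, ?_⟩
      · rw [hsplit, hTW, hv]
      · rw [hsplit, hS, hs]; push_cast; ring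
  obtain ⟨hv, hs⟩ := hper n σ
  rw [hX, hX, hv, hs, pow_zero, div_one, Real.exp_add]
  -- `e^{n y log λ} / λ^n = λ^{(y-1) n}`
  have hexp : Real.exp ((n : ℝ) * (y * Real.log lam)) = lam ^ ((n : ℝ) * y) := by
    rw [Real.rpow_def_of_pos hlam]; congr 1; ring
  have hpow : (lam ^ n : ℝ) = lam ^ ((n : ℝ)) := (Real.rpow_natCast lam n).symm
  rw [hexp, hpow]
  have hkey : lam ^ ((n : ℝ) * y) / lam ^ ((n : ℝ)) = lam ^ ((y - 1) * n) := by
    rw [← Real.rpow_sub hlam]; congr 1; ring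
  rw [← hkey]; ring

/-- **Periodic gauge ⇒ constant gauge gain per period** (the exponent of a Dombre–Gilson travelling wave is well defined).
If `S' = A` on `ℝ` and `A` is `p`-periodic (as along a travelling wave of the shell-shift map, period `p = 1/a`), then
`S(σ + p) − S(σ)` does not depend on `σ`; this constant is `y · log λ` in `dombreGilson_travellingWave_peakLaw`, i.e.
`y = (log λ)⁻¹ ∫_0^p A`. [cite: Mailybaev2013Bifurcations, §4 Thm. 2 (eq. (17))] [cite: DombreGilson1998, §3] -/
theorem dombreGilson_gaugeGain_const {S A : ℝ → ℝ} {p : ℝ} (hS : ∀ σ, HasDerivAt S (A σ) σ)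
    (hA : ∀ σ, A (σ + p) = A σ) (σ : ℝ) : S (σ + p) - S σ = S p - S 0 := by
  -- `g σ := S (σ + p) − S σ` has derivative `A (σ + p) − A σ = 0`
  have hg : ∀ x, HasDerivAt (fun σ => S (σ + p) - S σ) 0 x := by
    intro x
    have h1 : HasDerivAt (fun σ => S (σ + p)) (A (x + p)) x := HasDerivAt.comp_add_const x p (hS (x + p))
    have h := h1.sub (hS x)
    rw [hA, sub_self] at h
    exact h
  have hdiff : Differentiable ℝ (fun σ => S (σ + p) - S σ) := fun x => (hg x).differentiableAt
  have hzero : ∀ x, deriv (fun σ => S (σ + p) - S σ) x = 0 := fun x => (hg x).deriv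
  have := is_const_of_deriv_eq_zero hdiff hzero σ 0
  simpa using this

/-- **The renormalised lattice along an honest solution of the registered stubs' format.** If `X` solves Tao's viscous model
equation WITHIN `[0,s]` (the hypothesis shape of `PrimaryGradedAt` / `FwdCeilingKPAt`: `HasDerivWithinAt … (Icc 0 s) t` for
`t ∈ [0,s]`) and the clock reads an INTERIOR time `T σ ∈ (0,s)`, then the Dombre–Gilson lattice `dombreGilson_hasDerivAt` holds at
`σ` (interior points carry two-sided derivatives). [cite: Tao2016AveragedNS, §4 (4.13)] [cite: DombreGilson1998, §3] -/
theorem dombreGilson_hasDerivAt_of_within {ε₀ ν s : ℝ} (hε : 0 < ε₀) {m : ℕ} {α : Fin m → Fin m → Fin m → ℤ × ℤ × ℤ → ℝ}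
    {X : Fin m → ℤ → ℝ → ℝ} {T S : ℝ → ℝ} {A σ : ℝ} {i : Fin m} {k : ℤ}
    (hT : HasDerivAt T (Real.exp (-(S σ))) σ) (hS : HasDerivAt S A σ)
    (hode : ∀ t ∈ Set.Icc (0 : ℝ) s, HasDerivWithinAt (X i k)
      (quadTerm ε₀ α X i k t - ν * (1 + ε₀) ^ ((2 : ℝ) * k) * X i k t) (Set.Icc (0 : ℝ) s) t)
    (hin : T σ ∈ Set.Ioo (0 : ℝ) s) :
    HasDerivAt (fun σ' => Real.exp (-(S σ')) * ((1 + ε₀) ^ ((5 : ℝ) / 2 * (k : ℝ)) * X i k (T σ')))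
      ((∑ i₁ : Fin m, ∑ i₂ : Fin m, ∑ μ ∈ shiftSet,
        α i₁ i₂ i μ * (1 + ε₀) ^ ((5 : ℝ) / 2 * ((μ.2.2 : ℝ) - (μ.1 : ℝ) - (μ.2.1 : ℝ))) *
          ((Real.exp (-(S σ)) * ((1 + ε₀) ^ ((5 : ℝ) / 2 * ((k - μ.2.2 + μ.1 : ℤ) : ℝ)) * X i₁ (k - μ.2.2 + μ.1) (T σ))) *
            (Real.exp (-(S σ)) *
              ((1 + ε₀) ^ ((5 : ℝ) / 2 * ((k - μ.2.2 + μ.2.1 : ℤ) : ℝ)) * X i₂ (k - μ.2.2 + μ.2.1) (T σ))))) -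
        A * (Real.exp (-(S σ)) * ((1 + ε₀) ^ ((5 : ℝ) / 2 * (k : ℝ)) * X i k (T σ))) -
        ν * (1 + ε₀) ^ ((2 : ℝ) * k) * Real.exp (-(S σ)) *
          (Real.exp (-(S σ)) * ((1 + ε₀) ^ ((5 : ℝ) / 2 * (k : ℝ)) * X i k (T σ)))) σ := by
  have hmem : Set.Icc (0 : ℝ) s ∈ nhds (T σ) := Icc_mem_nhds hin.1 hin.2
  have hX : HasDerivAt (X i k)
      (quadTerm ε₀ α X i k (T σ) - ν * (1 + ε₀) ^ ((2 : ℝ) * k) * X i k (T σ)) (T σ) :=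
    (hode (T σ) (Set.Ioo_subset_Icc_self hin)).hasDerivAt hmem
  exact dombreGilson_hasDerivAt hε hT hS hX

/-- **Flux telescoping in the renormalised chain (the gauge numerator).** For the chain's renormalised quadratic part
`P_k = c₀ (λ w_k² − λ⁻¹ v_k v_{k+1})` with `w_k = v_{k-1}` (`w_0 = 0`: nothing below the datum shell), on the block of shells
`0..K`: `Σ_{k≤K} v_k P_k = c₀ ((λ − λ⁻¹) Σ_{k<K} v_k² v_{k+1} − λ⁻¹ v_K² v_{K+1})` — the bond fluxes telescope, leaving the
`(λ − λ⁻¹)`-weighted bulk sum and the flux out of the block. [cite: Mailybaev2013Bifurcations, §3 (11)–(12)]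
[cite: DombreGilson1998, §3] -/
theorem kpChain_dombreGilson_fluxTelescope (c₀ lam : ℝ) (v w : ℕ → ℝ) (hw0 : w 0 = 0) (hw : ∀ k, w (k + 1) = v k)
    (K : ℕ) :
    ∑ k ∈ range (K + 1), v k * (c₀ * (lam * w k ^ 2 - lam⁻¹ * (v k * v (k + 1)))) =
      c₀ * ((lam - lam⁻¹) * ∑ k ∈ range K, v k ^ 2 * v (k + 1) - lam⁻¹ * (v K ^ 2 * v (K + 1))) := by
  induction K with
  | zero => simp [hw0]; ring
  | succ K ih => rw [sum_range_succ, ih, sum_range_succ, hw]; ring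

/-- **The Galerkin gauge.** On a truncated block (`v_{K+1} = 0`, Mailybaev's Galerkin lattice) the gauge numerator is the bulk
sum alone: `Σ_{k≤K} v_k P_k = c₀ (λ − λ⁻¹) Σ_{k<K} v_k² v_{k+1}`; hence `A = c₀(λ − λ⁻¹) Σ_{k<K} v_k² v_{k+1} / Σ_{k≤K} v_k²`
satisfies the hypothesis of `dombreGilson_norm_conserved` and keeps `Σ v_k²` constant (`A ≥ 0` along non-negative solutions
when `λ ≥ 1`). [cite: Mailybaev2013Bifurcations, §3 (12)] -/
theorem kpChain_dombreGilson_galerkinGauge (c₀ lam : ℝ) (v w : ℕ → ℝ) (hw0 : w 0 = 0) (hw : ∀ k, w (k + 1) = v k)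
    (K : ℕ) (hK : v (K + 1) = 0) :
    ∑ k ∈ range (K + 1), v k * (c₀ * (lam * w k ^ 2 - lam⁻¹ * (v k * v (k + 1)))) =
      c₀ * (lam - lam⁻¹) * ∑ k ∈ range K, v k ^ 2 * v (k + 1) := by
  rw [kpChain_dombreGilson_fluxTelescope c₀ lam v w hw0 hw K, hK]; ring

/-- **Along a travelling wave the phase-sampled amplitudes sit EXACTLY on the DG scaling.** With `λ = b^{5/2}` and the hypotheses
of `dombreGilson_travellingWave_peakLaw`, the samples `m_n := X_n(T(σ₀ + n/a))` of one phase `σ₀` satisfy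
`m_n · b^{(5/2)(1−y)n} = m_0` for every `n` (so they converge trivially in the DG normalisation of
`Theorems.kpFront_barrier_of_exponent_lt`). [cite: Mailybaev2013Bifurcations, §4 Thm. 2] -/
theorem dombreGilson_travellingWave_dgScaling {b a y : ℝ} (hb : 1 < b)
    {v X : ℕ → ℝ → ℝ} {T S : ℝ → ℝ}
    (hTW : ∀ (n : ℕ) (σ : ℝ), v (n + 1) (σ + 1 / a) = v n σ)
    (hS : ∀ σ : ℝ, S (σ + 1 / a) = S σ + y * Real.log (b ^ ((5 : ℝ) / 2)))
    (hX : ∀ (n : ℕ) (σ : ℝ), X n (T σ) = Real.exp (S σ) * v n σ / (b ^ ((5 : ℝ) / 2)) ^ n) (σ₀ : ℝ) (n : ℕ) :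
    X n (T (σ₀ + n / a)) * b ^ ((5 : ℝ) / 2 * (1 - y) * (n : ℝ)) = X 0 (T σ₀) := by
  have hb0 : 0 ≤ b := by linarith
  have hlam : 0 < b ^ ((5 : ℝ) / 2) := Real.rpow_pos_of_pos (by linarith) _
  rw [dombreGilson_travellingWave_peakLaw hlam hTW hS hX n σ₀, ← Real.rpow_mul hb0]
  rw [mul_comm (b ^ _) (X 0 (T σ₀)), mul_assoc, ← Real.rpow_add (by linarith)]
  have : (5 : ℝ) / 2 * ((y - 1) * (n : ℝ)) + 5 / 2 * (1 - y) * (n : ℝ) = 0 := by ring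
  rw [this, Real.rpow_zero, mul_one]

/-- **TW with exponent `y < 4/5` ⇒ super-critical barrier along the wave.** If `b > 1`, `y < 4/5` and the phase samples are
non-negative, then `b^{2θn} · ½ m_n² ≤ D` for some `θ > 1/2`, `D ≥ 0` (`θ = (5/2)(1 − y)`, via `Theorems.kpFront_barrier_of_exponent_lt`).
This is the DG currency of the registered stubs' barrier for the primaries whose front is this wave. [cite: DombreGilson1998, §3] -/
theorem dombreGilson_travellingWave_barrier {b a y : ℝ} (hb : 1 < b) (hy : y < 4 / 5)
    {v X : ℕ → ℝ → ℝ} {T S : ℝ → ℝ}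
    (hTW : ∀ (n : ℕ) (σ : ℝ), v (n + 1) (σ + 1 / a) = v n σ)
    (hS : ∀ σ : ℝ, S (σ + 1 / a) = S σ + y * Real.log (b ^ ((5 : ℝ) / 2)))
    (hX : ∀ (n : ℕ) (σ : ℝ), X n (T σ) = Real.exp (S σ) * v n σ / (b ^ ((5 : ℝ) / 2)) ^ n) (σ₀ : ℝ)
    (hpos : ∀ n : ℕ, 0 ≤ X n (T (σ₀ + n / a))) :
    ∃ θ : ℝ, 1 / 2 < θ ∧ ∃ D : ℝ, 0 ≤ D ∧
      ∀ n : ℕ, b ^ (2 * θ * (n : ℝ)) * ((1 / 2 : ℝ) * X n (T (σ₀ + n / a)) ^ 2) ≤ D := by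
  have hconv : Filter.Tendsto (fun n : ℕ => X n (T (σ₀ + n / a)) * b ^ ((5 : ℝ) / 2 * (1 - y) * (n : ℝ))) Filter.atTop
      (nhds (X 0 (T σ₀))) := by
    have : (fun n : ℕ => X n (T (σ₀ + n / a)) * b ^ ((5 : ℝ) / 2 * (1 - y) * (n : ℝ))) = fun _ => X 0 (T σ₀) := by
      funext n; exact dombreGilson_travellingWave_dgScaling hb hTW hS hX σ₀ n
    rw [this]; exact tendsto_const_nhds
  exact kpFront_barrier_of_exponent_lt hb hy hpos hconv

/-- **TW with exponent `y ≥ 4/5` ⇒ NO super-critical barrier along the wave** (the kill line of the crux in DG currency, via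
`Theorems.kpFront_noBarrier_of_exponent_ge`): if the wave is non-trivial at the phase `σ₀` (`X_0(Tσ₀) > 0`), then for every
`θ > 1/2` the weighted samples `b^{2θn} · ½ m_n²` are unbounded. [cite: DombreGilson1998, §3] -/
theorem dombreGilson_travellingWave_noBarrier {b a y : ℝ} (hb : 1 < b) (hy : 4 / 5 ≤ y)
    {v X : ℕ → ℝ → ℝ} {T S : ℝ → ℝ}
    (hTW : ∀ (n : ℕ) (σ : ℝ), v (n + 1) (σ + 1 / a) = v n σ)
    (hS : ∀ σ : ℝ, S (σ + 1 / a) = S σ + y * Real.log (b ^ ((5 : ℝ) / 2)))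
    (hX : ∀ (n : ℕ) (σ : ℝ), X n (T σ) = Real.exp (S σ) * v n σ / (b ^ ((5 : ℝ) / 2)) ^ n) (σ₀ : ℝ)
    (hL : 0 < X 0 (T σ₀)) :
    ∀ θ : ℝ, 1 / 2 < θ → ∀ D : ℝ, ∃ n : ℕ, D < b ^ (2 * θ * (n : ℝ)) * ((1 / 2 : ℝ) * X n (T (σ₀ + n / a)) ^ 2) := by
  have hconv : Filter.Tendsto (fun n : ℕ => X n (T (σ₀ + n / a)) * b ^ ((5 : ℝ) / 2 * (1 - y) * (n : ℝ))) Filter.atTop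
      (nhds (X 0 (T σ₀))) := by
    have : (fun n : ℕ => X n (T (σ₀ + n / a)) * b ^ ((5 : ℝ) / 2 * (1 - y) * (n : ℝ))) = fun _ => X 0 (T σ₀) := by
      funext n; exact dombreGilson_travellingWave_dgScaling hb hTW hS hX σ₀ n
    rw [this]; exact tendsto_const_nhds
  exact kpFront_noBarrier_of_exponent_ge hb hy hL hconv

end Summit.NavierStokesRegularity.NavierStokesRegularity.Theorems

end
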